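import Summits.CriticalPhenomena.PercolationContinuityZ3.Theorems.PercNearOneGluingNoHeavyPcintMemCertZ2
import Summits.CriticalPhenomena.PercolationContinuityZ3.Theorems.PercNearOneGluingNoHeavyPcintClosingCountKernelZ2
import Summits.CriticalPhenomena.PercolationContinuityZ3.Theorems.PercNearOneGluingNoHeavyPcintLoopExclusionRungSixZ3
import HarnessLib

/-!
# CriticalPhenomena/PercolationContinuityZ3 — Theorems/PercNearOneGluingNoHeavyPcintLoopExclusionRungsZ2.lean: the `d = 2` row of the factor table — `R_8(ℤ²) ∈ [0.35, 0.36] < R_6(ℤ²) ∈ [0.42, 0.43] < R_4(ℤ²) ∈ [0.56, 0.61]`, and `R_6(ℤ²) < R_6(ℤ³)`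

Lane prim-pcint, STRUCTURE rule.  From the two-sided certificates of …MemCertZ2 (`Δ_6(ℤ²) ∈ [0.0196, 0.02003]`, `Δ_8(ℤ²) ∈ [0.0112, 0.01135]`,
`μ_4(ℤ²) ∈ [2.83117, 2.83118]`, `μ_6(ℤ²) ∈ [2.77559085, 2.77559143]`), the kernel polygon counts of …ClosingCountKernelZ2
(`2·6·p_6(ℤ²) = 24`, `2·8·p_8(ℤ²) = 112`) and the closed form `R_4 = (81/8)·ln(3/μ_4)` (…RungFourCounts):
**`loopCompat_four_zd2_bounds`** (`0.56 ≤ R_4(ℤ²) ≤ 0.61`; measured 0.5864), **`loopCompat_six_zd2_bounds`** (`0.42 ≤ R_6(ℤ²) ≤ 0.43`;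
measured 0.4255), **`loopCompat_eight_zd2_bounds`** (`0.35 ≤ R_8(ℤ²) ≤ 0.36`; measured 0.3548); hence **`loopCompat_chain_zd2 :
R_8(ℤ²) < R_6(ℤ²) < R_4(ℤ²) < 1`** (clauses (a) at `(2,3)`, `(2,4)` and (c) at `(2,2)`, `(2,3)`) and, with …RungSixZ3,
**`loopCompat_six_zd2_lt_zd3 : R_6(ℤ²) < R_6(ℤ³)`** (clause (b) at `(2,3)`; `(2,2)` is …RungFourDimension).

HONEST FRAMING: elementary consequences of kernel certificates; nothing here is used by a certified `p_c` cell.  Written by prim-pcint-2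
gen 17 (prover-prim-pcint-2-g17-0), 2026-08-25.
-/

noncomputable section

open Literature.Probability.LatticeModels Literature.Probability.Percolation
open Summit.CriticalPhenomena.PercolationContinuityZ3.Theorems.Pcint

namespace Summit.CriticalPhenomena.PercolationContinuityZ3.Theorems.Pcint.MemoryTail

/-- **`0.56 ≤ R_4(ℤ²) ≤ 0.61`** (`R_4(ℤ²) = (81/8)·ln(3/μ_4)`, `1 − 1/t ≤ ln t ≤ t − 1`; measured 0.5864). [this work] -/
theorem loopCompat_four_zd2_bounds : (0.56 : ℝ) ≤ loopCompat 2 4 ∧ loopCompat 2 4 ≤ 0.61 := by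
  rw [loopCompat_four_eq (d := 2) le_rfl]
  have hμlo := memGrowth_four_zd2_ge
  have hμhi := memGrowth_four_zd2_le
  have hμpos : (0 : ℝ) < memGrowth 2 4 := by linarith
  have hq : (0 : ℝ) < (2 * ((2 : ℕ) : ℝ) - 1) / memGrowth 2 4 := div_pos (by norm_num) hμpos
  have hlog₁ := Real.one_sub_inv_le_log_of_pos hq
  have hlog₂ := Real.log_le_sub_one_of_pos hq
  rw [inv_div] at hlog₁
  have h1 : memGrowth 2 4 / (2 * ((2 : ℕ) : ℝ) - 1) ≤ 0.943727 := by
    rw [div_le_iff₀ (by norm_num : (0 : ℝ) < 2 * ((2 : ℕ) : ℝ) - 1)]; norm_num; linarith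
  have h2 : (2 * ((2 : ℕ) : ℝ) - 1) / memGrowth 2 4 ≤ 1.059633 := by
    rw [div_le_iff₀ hμpos]; norm_num; linarith
  have hc' : (2 * ((2 : ℕ) : ℝ) - 1) ^ 4 / (2 * ((2 : ℕ) : ℝ) * (2 * ((2 : ℕ) : ℝ) - 2)) = 81 / 8 := by norm_num
  rw [hc']
  constructor <;> nlinarith

/-- `f_6(ℤ²) = 24/μ_4⁶` two-sided: `24/2.83118⁶ ≤ f_6(ℤ²) ≤ 24/2.83117⁶`. [this work] -/
theorem memLoopDensity_six_zd2_bounds :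
    (24 : ℝ) / 2.83118 ^ 6 ≤ memLoopDensity 2 6 ∧ memLoopDensity 2 6 ≤ (24 : ℝ) / 2.83117 ^ 6 := by
  unfold memLoopDensity
  rw [show (6 : ℕ) - 2 = 4 from rfl]
  have hμlo := memGrowth_four_zd2_ge
  have hμhi := memGrowth_four_zd2_le
  have hμpos : (0 : ℝ) < memGrowth 2 4 := by linarith
  have hcc : ((closingCount 2 6 : ℕ) : ℝ) = 24 := by rw [closingCount_six_zd2]; norm_num
  rw [hcc]
  exact ⟨div_le_div_of_nonneg_left (by norm_num) (by positivity) (pow_le_pow_left₀ hμpos.le hμhi 6),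
    div_le_div_of_nonneg_left (by norm_num) (by positivity) (pow_le_pow_left₀ (by norm_num) hμlo 6)⟩

/-- `f_8(ℤ²) = 112/μ_6⁸` two-sided: `112/2.7755915⁸ ≤ f_8(ℤ²) ≤ 112/2.7755908⁸`. [this work] -/
theorem memLoopDensity_eight_zd2_bounds :
    (112 : ℝ) / 2.7755915 ^ 8 ≤ memLoopDensity 2 8 ∧ memLoopDensity 2 8 ≤ (112 : ℝ) / 2.7755908 ^ 8 := by
  unfold memLoopDensity
  rw [show (8 : ℕ) - 2 = 6 from rfl]
  have hμlo : (2.7755908 : ℝ) ≤ memGrowth 2 6 := le_trans (by norm_num) memGrowth_six_zd2_ge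
  have hμhi : memGrowth 2 6 ≤ 2.7755915 := le_trans memGrowth_six_zd2_le (by norm_num)
  have hμpos : (0 : ℝ) < memGrowth 2 6 := by linarith
  have hcc : ((closingCount 2 8 : ℕ) : ℝ) = 112 := by rw [closingCount_eight_zd2]; norm_num
  rw [hcc]
  exact ⟨div_le_div_of_nonneg_left (by norm_num) (by positivity) (pow_le_pow_left₀ hμpos.le hμhi 8),
    div_le_div_of_nonneg_left (by norm_num) (by positivity) (pow_le_pow_left₀ (by norm_num) hμlo 8)⟩

/-- **`0.42 ≤ R_6(ℤ²) ≤ 0.43`** (measured 0.4255). [this work] -/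
theorem loopCompat_six_zd2_bounds : (0.42 : ℝ) ≤ loopCompat 2 6 ∧ loopCompat 2 6 ≤ 0.43 := by
  unfold loopCompat
  obtain ⟨hflo, hfhi⟩ := memLoopDensity_six_zd2_bounds
  obtain ⟨hΔlo, hΔhi⟩ := memLoopCost_six_zd2_bounds
  have hfpos : 0 < memLoopDensity 2 6 := lt_of_lt_of_le (by norm_num) hflo
  rw [le_div_iff₀ hfpos, div_le_iff₀ hfpos]
  have c1 : 0.42 * ((24 : ℝ) / 2.83117 ^ 6) ≤ 0.0196 := by norm_num
  have c2 : (0.02003 : ℝ) ≤ 0.43 * ((24 : ℝ) / 2.83118 ^ 6) := by norm_num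
  constructor <;> nlinarith

/-- **`0.35 ≤ R_8(ℤ²) ≤ 0.36`** (measured 0.3548). [this work] -/
theorem loopCompat_eight_zd2_bounds : (0.35 : ℝ) ≤ loopCompat 2 8 ∧ loopCompat 2 8 ≤ 0.36 := by
  unfold loopCompat
  obtain ⟨hflo, hfhi⟩ := memLoopDensity_eight_zd2_bounds
  obtain ⟨hΔlo, hΔhi⟩ := memLoopCost_eight_zd2_bounds
  have hfpos : 0 < memLoopDensity 2 8 := lt_of_lt_of_le (by norm_num) hflo
  rw [le_div_iff₀ hfpos, div_le_iff₀ hfpos]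
  have c1 : 0.35 * ((112 : ℝ) / 2.7755908 ^ 8) ≤ 0.0112 := by norm_num
  have c2 : (0.01135 : ℝ) ≤ 0.36 * ((112 : ℝ) / 2.7755915 ^ 8) := by norm_num
  constructor <;> nlinarith

/-- **`R_8(ℤ²) < R_6(ℤ²) < R_4(ℤ²) < 1`**: the `d = 2` column strictly decreasing over the first three rungs
(clauses (c) at `(2,2)`, `(2,3)`). [this work] -/
theorem loopCompat_chain_zd2 : loopCompat 2 8 < loopCompat 2 6 ∧ loopCompat 2 6 < loopCompat 2 4 ∧ loopCompat 2 4 < 1 :=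
  ⟨lt_of_le_of_lt loopCompat_eight_zd2_bounds.2 (lt_of_lt_of_le (by norm_num) loopCompat_six_zd2_bounds.1),
    lt_of_le_of_lt loopCompat_six_zd2_bounds.2 (lt_of_lt_of_le (by norm_num) loopCompat_four_zd2_bounds.1),
    lt_of_le_of_lt loopCompat_four_zd2_bounds.2 (by norm_num)⟩

/-- `loopCompatStrictAntiMemory` at `(2, 2)` and `(2, 3)`. [this work] -/
theorem loopCompatStrictAntiMemory_two :
    loopCompat 2 (2 * 2 + 2) < loopCompat 2 (2 * 2) ∧ loopCompat 2 (2 * 3 + 2) < loopCompat 2 (2 * 3) :=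
  ⟨loopCompat_chain_zd2.2.1, loopCompat_chain_zd2.1⟩

/-- `loopCompatWindow` at `(2, 3)` and `(2, 4)`: `0 < R_6(ℤ²) < 1`, `0 < R_8(ℤ²) < 1`. [this work] -/
theorem loopCompatWindow_two :
    (0 < loopCompat 2 (2 * 3) ∧ loopCompat 2 (2 * 3) < 1) ∧ (0 < loopCompat 2 (2 * 4) ∧ loopCompat 2 (2 * 4) < 1) :=
  ⟨⟨lt_of_lt_of_le (by norm_num) loopCompat_six_zd2_bounds.1, lt_of_le_of_lt loopCompat_six_zd2_bounds.2 (by norm_num)⟩,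
    ⟨lt_of_lt_of_le (by norm_num) loopCompat_eight_zd2_bounds.1, lt_of_le_of_lt loopCompat_eight_zd2_bounds.2 (by norm_num)⟩⟩

/-- **`R_6(ℤ²) < R_6(ℤ³)`**: clause (b) at the second rung, `(d, m) = (2, 3)`. [this work] -/
theorem loopCompat_six_zd2_lt_zd3 : loopCompat 2 6 < loopCompat 3 6 :=
  lt_of_le_of_lt loopCompat_six_zd2_bounds.2 (lt_of_lt_of_le (by norm_num) loopCompat_six_zd3_ge)

/-- `loopCompatStrictMonoDim` at `(2, 3)`. [this work] -/
theorem loopCompatStrictMonoDim_two_three : loopCompat 2 (2 * 3) < loopCompat (2 + 1) (2 * 3) :=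
  loopCompat_six_zd2_lt_zd3

end Summit.CriticalPhenomena.PercolationContinuityZ3.Theorems.Pcint.MemoryTail
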